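import Summits.BirchSwinnertonDyer.BirchSwinnertonDyer.Theorems.SchneiderFreeAdditiveX3UpperGordCellThreeAnomalousOfPartnerClass
import Summits.BirchSwinnertonDyer.BirchSwinnertonDyer.Theorems.EisensteinPrimesResidualCharacterSelmerFiniteOfFact
import HarnessLib

/-!
# Route `SchneiderFreeAdditiveX3Upper` (K1 wing): crux r3 `GordTwoBranchCoIMCField` BY NAME with its `μ`-input from PUBLISHED facts (CGLS 2022 Prop. 14)
# and cell `bsd-eis`'s typed Keller–Yin 2402.12781 [RH] + [PWL-θ] — NO `_OPEN` `μ`-claim: the wing's only preprint input is Keller–Yin's divisibility [DIV.dvd]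

Cell `bsd-schneider-ideate`, seat `bsd-schneider-door-c5` (prover, generation 29; assembly layer; `--supports` 20365; FYI door 19177).
PARTITION: board row B6 ∩ X3 ∩ sst-twist, `r = 1`, (G-ord, `e = 2`) half (2 560 pairs; CLASS-WIDE statement, all odd `p`) of `Rank1Residual.partition` —
ASSEMBLY; types-the-object-of nothing; closes none of B6's cells (BSD NOT advanced).  bears_on: K1-wing (20365 r3 `GordTwoBranchCoIMCField`), K1-door (19177).

## What

The wing crux r3 is the class-wide FIELD co-socket `Upper.AdditiveIMCUpperBDPInputManinAtField W p K` at every Keller–Yin-normalised curve of the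
(G-ord, `e = 2`) cell, odd `p`, `d_K ≠ −3`.  Generations 22–23 derived it BY NAME from [DIV.dvd] + a `μ`-CLAIM of the preprint
(`thm351_muInvariant_eq_zero_OPEN`, resp. the character-level `prop125_residualCharacterUnrSelmer_finite_OPEN`) + published facts
(`KYDvdOnly.gordTwoBranchCoIMCField_of_hsieh_of_lzz_of_KY_dvd_of_prop125_of_castellaHsieh_signed`).  The `μ`-input is now available WITHOUT any `_OPEN`
claim at EVERY odd `p` and EVERY curve of the cell, by a three-way split:
* `p ≥ 5`: CGLS 2022 Prop. 14 (PUBLISHED) through the non-anomalous clause, automatic by inertia (generation 23,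
  `UpperOfPrintDvd.additiveIMCUpperBDPInputManinAtField_of_hsieh_of_lzz_of_KY_dvd_of_prop14_of_castellaHsieh_signed`);
* `p = 3`, every good-ordinary `(−3)`-twist model non-anomalous (NAT): CGLS Prop. 14 through the Frobenius of the twist (generation 25,
  `UpperOfPrintNonAnomalousTwist.additiveIMCUpperBDPInputManinAtField_…_of_forall_twist`);
* `p = 3`, an anomalous good-ordinary twist model: [RH] + [PWL-θ] read at the RIBET-normalised partner, transported to `W` by the ISOGENY INVARIANCE
  OF THE RESIDUAL PAIR (generation 29, `UpperThreeAnomalousOfPartnerClass.additiveIMCUpperBDPInputManinAtField_three_of_RH_of_PWL_of_partnerClass` ∘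
  `exists_partnerClass_of_anomalous_twist_model`);
and at `p = 3` the two sub-cases EXHAUST the cell (`forall_twist_not_anomalous_or_exists_anomalous_twist`).

* §1 **`gordTwoBranchCoIMCField_of_hsieh_of_lzz_of_KY_dvd_of_prop14_of_RH_of_PWL_of_castellaHsieh_signed : Ko → Par → Hsieh A → LZZ → [DIV.dvd] →
  CGLS Prop. 14 → CHσ → [RH] → [PWL-θ] → GordTwoBranchCoIMCField`** — the wing crux r3 BY NAME.
* §2 `…_of_prop125dim_…`: the same with CGLS Prop. 14's finiteness clause SUPPLIED from its module clause `prop125_characterGrSelmerDual_torsion_muZero_dim`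
  (CGLS Prop. 1.2.5 as printed) by cell `bsd-eis`'s tree theorem `prop14_residualCharacterSelmer_finite_of_fact`.

INPUT LEDGER of the wing crux r3 (class-wide, all odd `p`): BEFORE (generation 23) {Ko, modularity, Hsieh A, LZZ, CHσ} PUB ∪ {[DIV.dvd] PRE,
`prop125_residualCharacterUnrSelmer_finite_OPEN` PRE}; AFTER {Ko, modularity, Hsieh A, LZZ, CHσ, CGLS Prop. 14 (or Prop. 1.2.5)} PUB ∪ {[DIV.dvd] PRE} ∪
{[RH] `thm122_rubinHida_residualPair_unrSelmer`, [PWL-θ] `prop125_residualPair_unrSelmer_imprimitive`} (typed by cell `bsd-eis` WITHOUT `_OPEN`: compositions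
of Rubin 1991/94, Hida 2010, Coates–Wiles/de Shalit, Pollack–Weston 2011 A.2, CGLS Lemma 1.1.1; the anomalous `𝓕_nr` formulation is written in
arXiv:2402.12781 — their docstrings say exactly this).  The ONE remaining preprint input of the wing crux is Keller–Yin's Heegner-point Kolyvagin divisibility.

HONEST FRAMING: a composition CONDITIONAL BY NAME on the displayed statements (the item records a `conditional-result`; it is NOT closed: [DIV.dvd] is an
unrefereed claim and [RH]/[PWL-θ] are typed facts, not tree theorems); nothing analytic; BSD is proved for no curve; «closes rung: none».  No definition,
no named fact, no `sorry`.
References: [KellerYin2024b] Thm. 3.3.6 ∘ Prop. 3.4.4 ([DIV.dvd]; arXiv:2410.23241 p. 19); [KellerYin2024] Thm. 1.2.2, Prop. 1.2.5, Prop. 1.3.1 (arXiv:2402.12781v2);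
[CastellaGrossiLeeSkinner2022] §1.2 Prop. 1.2.5 / arXiv Prop. 14 (Invent. Math. 227); [CastellaHsieh2018] §3.3; [Hsieh2014] Thm. A; [LiuZhangZhang2018]
Thms. 1.5.1/1.5.3; [Ribet1976] Prop. 2.1; this seat p666552 (gen 23), p675920 (gen 25), p697890 + the partner-class file (gen 29); cell `bsd-eis`
`EisensteinPrimesResidualCharacterSelmerFiniteOfFact`.
-/

set_option autoImplicit false
set_option linter.dupNamespace false -- the summit namespace `…BirchSwinnertonDyer.BirchSwinnertonDyer.Theorems` (Sub = Summit, D-0017) trips it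

noncomputable section

open scoped Classical NumberField

open Field NumberField IsDedekindDomain WeierstrassCurve
  Literature.NumberTheory.EllipticCurves Literature.NumberTheory.EllipticCurves.GreenbergSelmer
  Literature.NumberTheory.GaloisRepresentations Literature.NumberTheory.GaloisCohomology
  Literature.NumberTheory.EllipticCurves.ModularForms Literature.NumberTheory.EllipticCurves.Rank1Residual
  Literature.NumberTheory.EllipticCurves.Rank1Residual.Typed
  Literature.NumberTheory.EllipticCurves.IwasawaAlgebra
  Literature.NumberTheory.EllipticCurves.KellerYin2024 Literature.NumberTheory.EllipticCurves.CaiShuTian2014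
  Summit.BirchSwinnertonDyer.Rank1Residual Summit.BirchSwinnertonDyer.Rank1Residual.Additive
  Summit.BirchSwinnertonDyer.Rank1Residual.X11b
  Summit.BirchSwinnertonDyer.Rank1Residual.X11b.AcSelmer Summit.BirchSwinnertonDyer.Rank1Residual.X11b.Halves
  Summit.BirchSwinnertonDyer.BirchSwinnertonDyer.Theorems
  Summit.BirchSwinnertonDyer.BirchSwinnertonDyer.Theorems.SchneiderFree
  Summit.BirchSwinnertonDyer.BirchSwinnertonDyer.Theorems.SchneiderFree.Upper
  Summit.BirchSwinnertonDyer.BirchSwinnertonDyer.Theorems.SchneiderFreeAdditiveX3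
  Summit.BirchSwinnertonDyer.BirchSwinnertonDyer.Theorems.SchneiderFreeAdditiveX3.UpperOfPrint
  Summit.BirchSwinnertonDyer.BirchSwinnertonDyer.Theorems.SchneiderFreeAdditiveX3.UpperOfPrintDvd
  Summit.BirchSwinnertonDyer.BirchSwinnertonDyer.Theorems.SchneiderFreeAdditiveX3.UpperOfPrintNonAnomalousTwist
  Summit.BirchSwinnertonDyer.BirchSwinnertonDyer.Theorems.SchneiderFreeAdditiveX3.UpperThreeAnomalousOfPartnerClass

open Literature.NumberTheory.EllipticCurves.KellerYin2024 (thm122_rubinHida_residualPair_unrSelmer prop125_residualPair_unrSelmer_imprimitive)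
open Literature.NumberTheory.EllipticCurves.CastellaGrossiLeeSkinner2022 (prop14_residualCharacterSelmer_finite
  prop125_characterGrSelmerDual_torsion_muZero_dim)
open Summit.BirchSwinnertonDyer.BirchSwinnertonDyer.Theorems.TeichmullerPairUnramifiedAtMult (prop14_residualCharacterSelmer_finite_of_fact)

open Summit.BirchSwinnertonDyer.BirchSwinnertonDyer.Theses.SchneiderFreeAdditiveX3Upper

namespace Summit.BirchSwinnertonDyer.BirchSwinnertonDyer.Theorems.SchneiderFreeAdditiveX3.UpperWingGordOfPrintRHPWL

/-! ### §1 The wing crux r3 BY NAME, `μ` from CGLS Prop. 14 ∪ [RH] + [PWL-θ] -/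

/-- **WING CRUX r3 `GordTwoBranchCoIMCField` BY NAME ⇐ Kolyvagin ∧ modularity ∧ Hsieh 2014 Thm. A ∧ Liu–Zhang–Zhang 2018 ∧ Castella–Hsieh signed existence ∧
CGLS 2022 Prop. 14 (ALL PUBLISHED, typed as Props) ∧ [DIV.dvd] (Keller–Yin 2410.23241 Thm. 3.3.6 ∘ Prop. 3.4.4, the divisibility — the ONE preprint input) ∧ [RH]
∧ [PWL-θ] (cell `bsd-eis`'s typed Keller–Yin 2402.12781 Thm. 1.2.2 / Prop. 1.2.5 compositions).**  For every globally minimal `W` with `p ≠ 2`, `ClassX3 W p`,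
`SubGordTwo W p` in Keller–Yin's normalisation and every imaginary quadratic `K` with `d_K ≠ −3`: `Upper.AdditiveIMCUpperBDPInputManinAtField W p K` — at
`p ≥ 5` by generation 23's co-socket (CGLS Prop. 14, inertia), at `p = 3` by the dichotomy NAT / anomalous twist model (generation 29's
`forall_twist_not_anomalous_or_exists_anomalous_twist`): NAT ⟹ generation 25's co-socket (CGLS Prop. 14, Frobenius of the twist); anomalous model ⟹
generation 29's partner-class co-socket ([RH] + [PWL-θ] at the Ribet-normalised partner, the isogeny invariance of the residual pair).  CONDITIONAL BY NAME;
the item stays OPEN (a `conditional-result`); nothing asserted about BSD.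
[cite: KellerYin2024b, Thm. 3.3.6 and Prop. 3.4.4, divisibility clause (arXiv:2410.23241 p. 19) (preprint; hypothesis)]
[cite: KellerYin2024, Thm. 1.2.2, Prop. 1.2.5, Prop. 1.3.1 (arXiv:2402.12781v2)]
[cite: CastellaGrossiLeeSkinner2022, §1.2 Prop. 14 (arXiv:2008.02571; Invent. Math. 227 (2022))]
[cite: CastellaHsieh2018, §3.3, Def. 3.7 and Prop. 3.8] [cite: Hsieh2014, Thm. A p. 712 (Doc. Math. 19)]
[cite: LiuZhangZhang2018, Thm 1.5.1 and Thm 1.5.3 (Duke Math. J. 167 pp. 748–749)] [cite: Ribet1976, Prop. 2.1] -/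
theorem gordTwoBranchCoIMCField_of_hsieh_of_lzz_of_KY_dvd_of_prop14_of_RH_of_PWL_of_castellaHsieh_signed
    (hKo : ∀ (N : ℕ) [NeZero N] (W : WeierstrassCurve ℚ) (K : Type) [Field K] [NumberField K],
      Literature.NumberTheory.EllipticCurves.kolyvagin N W K)
    (hPar : nonempty_modularParametrizationData)
    (hA : Hsieh2014.thmA_exists_isHsiehLFunction_unrPeriod_anyLevel)
    (hL : LiuZhangZhang2018.thm151_thm153_modularCurve_heegnerVector_additive)
    (hdvd : thm336_dvd_branch_OPEN) (h14 : prop14_residualCharacterSelmer_finite)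
    (hCHσ : castellaHsieh2018_exists_isBranchBDPLFunction_signed)
    (hRH : thm122_rubinHida_residualPair_unrSelmer) (hPWL : prop125_residualPair_unrSelmer_imprimitive) :
    GordTwoBranchCoIMCField := by
  intro W _ _ p _ hp2 hX hSG hlat K _ _ _ hdK
  have hp : p.Prime := Fact.out
  by_cases h3 : p = 3
  · subst h3
    rcases UpperThreeAnomalousOfPartnerClass.forall_twist_not_anomalous_or_exists_anomalous_twist W hX hSG with hNAT | ⟨V₀, _, _, C₀, hord₀, hC₀, hanom₀⟩
    · exact additiveIMCUpperBDPInputManinAtField_of_hsieh_of_lzz_of_KY_dvd_of_prop14_of_castellaHsieh_signed_of_forall_twist hKo hPar hA hL hdvd h14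
        hCHσ hp2 hX hSG hNAT hlat K hdK
    · obtain ⟨V, _, _, hV, hord, hanom, hlatV⟩ :=
        UpperThreeAnomalousOfPartnerClass.exists_partnerClass_of_anomalous_twist_model hX.1 C₀ hC₀ hord₀ hanom₀
      exact UpperThreeAnomalousOfPartnerClass.additiveIMCUpperBDPInputManinAtField_three_of_RH_of_PWL_of_partnerClass hKo hPar hA hL hdvd hCHσ hRH
        hPWL hX hSG hlat hV hord hanom hlatV K hdK
  · have hp5 : 5 ≤ p := by
      have h2 := hp.two_le
      have h4 : p ≠ 4 := by rintro rfl; exact absurd hp (by decide)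
      omega
    exact UpperOfPrintDvd.additiveIMCUpperBDPInputManinAtField_of_hsieh_of_lzz_of_KY_dvd_of_prop14_of_castellaHsieh_signed hKo hPar hA hL hdvd h14
      hCHσ hp5 hX hSG hlat K hdK

/-! ### §2 The same with CGLS Prop. 14's finiteness clause supplied from Prop. 1.2.5's module clause (cell `bsd-eis`'s tree theorem) -/

/-- **WING CRUX r3 BY NAME, with CGLS's finiteness clause (arXiv Prop. 14) SUPPLIED from its module clause** `prop125_characterGrSelmerDual_torsion_muZero_dim`
(CGLS 2022 Prop. 1.2.5 as printed: the Greenberg Selmer dual of a non-anomalous character is torsion with `μ = 0` and the printed `λ`) by cell `bsd-eis`'s tree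
theorem `TeichmullerPairUnramifiedAtMult.prop14_residualCharacterSelmer_finite_of_fact`.  CONDITIONAL BY NAME; nothing asserted about BSD.
[cite: CastellaGrossiLeeSkinner2022, §1.2 Prop. 1.2.5 and Lemma 1.2.4 (arXiv:2008.02571 Prop. 14, Lemma 13; Invent. Math. 227 (2022) 517–580)]
[cite: KellerYin2024b, Thm. 3.3.6 and Prop. 3.4.4 (arXiv:2410.23241 p. 19) (preprint; hypothesis)] [cite: KellerYin2024, Thm. 1.2.2, Prop. 1.2.5 (arXiv:2402.12781v2)] -/
theorem gordTwoBranchCoIMCField_of_hsieh_of_lzz_of_KY_dvd_of_prop125dim_of_RH_of_PWL_of_castellaHsieh_signed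
    (hKo : ∀ (N : ℕ) [NeZero N] (W : WeierstrassCurve ℚ) (K : Type) [Field K] [NumberField K],
      Literature.NumberTheory.EllipticCurves.kolyvagin N W K)
    (hPar : nonempty_modularParametrizationData)
    (hA : Hsieh2014.thmA_exists_isHsiehLFunction_unrPeriod_anyLevel)
    (hL : LiuZhangZhang2018.thm151_thm153_modularCurve_heegnerVector_additive)
    (hdvd : thm336_dvd_branch_OPEN) (h125 : prop125_characterGrSelmerDual_torsion_muZero_dim)
    (hCHσ : castellaHsieh2018_exists_isBranchBDPLFunction_signed)
    (hRH : thm122_rubinHida_residualPair_unrSelmer) (hPWL : prop125_residualPair_unrSelmer_imprimitive) :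
    GordTwoBranchCoIMCField :=
  gordTwoBranchCoIMCField_of_hsieh_of_lzz_of_KY_dvd_of_prop14_of_RH_of_PWL_of_castellaHsieh_signed hKo hPar hA hL hdvd
    (prop14_residualCharacterSelmer_finite_of_fact h125) hCHσ hRH hPWL

/-! ### §3 Per pair on the WHOLE (G-ord, `e = 2`) cell at EVERY odd `p`: the UPPER half of BSD_p from the twist-unit datum alone
(appended by door-c5 gen 29 after p698824: `p = 3` is generation 29's `…UpperThreeAnomalousOfPartnerClass` §4, `p ≥ 5` generation 23's `…UpperGordCellOfPrintDvdOnly` §3) -/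

/-- **UPPER half per pair on the WHOLE (G-ord, `e = 2`) cell at EVERY ODD `p` from the twist-unit datum ALONE** ⇐ `PrintedFacts` ∧ Hsieh 2014 Thm. A ∧
Liu–Zhang–Zhang 2018 ∧ CGLS 2022 Prop. 14 ∧ Castella–Hsieh signed (PUBLISHED) ∧ [DIV.dvd] (Keller–Yin 2410.23241, the divisibility — PREPRINT) ∧ [RH] ∧
[PWL-θ] (cell `bsd-eis`'s typed Keller–Yin 2402.12781 Thm. 1.2.2 / Prop. 1.2.5; used at `p = 3` only).  For every globally minimal `W/ℚ` with `r_an = 1`,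
`p` odd, `ClassX3 W p`, `SubGordTwo W p` and `Upper.TwistUnitFieldOffSliverAt W p`: `MissingUpperBoundAt W p` (`ord_p #Ш(E) ≤ ord_p #Ш(E)_an`) — `p ≥ 5`:
generation 23's `UpperOfPrintDvd.missingUpperBoundAt_gordTwo_fiveLe_…` (the non-anomalous clause by inertia); `p = 3`: generation 29's
`UpperThreeAnomalousOfPartnerClass.missingUpperBoundAt_gordTwo_three_…` (NAT ∨ anomalous twist model; Ribet-normalised partner).  No per-pair hypothesis
beyond the TU datum (census: 2 560 (G-ord) pairs, TU certified on all, generation 21).  CONDITIONAL BY NAME; the LOWER half is not here; closes no item;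
BSD not advanced.
[cite: CastellaGrossiLeeSkinner2022, §1.2 Prop. 14 (arXiv:2008.02571; Invent. Math. 227 (2022))]
[cite: KellerYin2024b, Thm. 3.3.6 and Prop. 3.4.4, divisibility clause (arXiv:2410.23241 p. 19) (preprint; hypothesis)]
[cite: KellerYin2024, Thm. 1.2.2, Prop. 1.2.5, Prop. 1.3.1 (arXiv:2402.12781v2)] [cite: JetchevSkinnerWan2017, §7.4.1 (arXiv:1512.06894 p. 30)]
[cite: CastellaHsieh2018, §3.3, Def. 3.7 and Prop. 3.8] [cite: Miller2011LMS, Def. 1.1] -/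
theorem missingUpperBoundAt_gordTwo_odd_of_printedFacts_of_twistUnitAt_of_hsieh_of_lzz_of_KY_dvd_of_prop14_of_RH_of_PWL_of_castellaHsieh_signed
    (hF : PrintedFacts) (hA : Hsieh2014.thmA_exists_isHsiehLFunction_unrPeriod_anyLevel)
    (hL : LiuZhangZhang2018.thm151_thm153_modularCurve_heegnerVector_additive)
    (hdvd : thm336_dvd_branch_OPEN) (h14 : prop14_residualCharacterSelmer_finite)
    (hCHσ : castellaHsieh2018_exists_isBranchBDPLFunction_signed)
    (hRH : thm122_rubinHida_residualPair_unrSelmer) (hPWL : prop125_residualPair_unrSelmer_imprimitive) :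
    ∀ (W : WeierstrassCurve ℚ) [W.IsElliptic] [W.IsGloballyMinimal] (p : ℕ) [Fact p.Prime],
      p ≠ 2 → W.analyticRank = 1 → ClassX3 W p → Additive.SubGordTwo W p → Upper.TwistUnitFieldOffSliverAt W p →
      MissingUpperBoundAt W p := by
  intro W _ _ p _ hp2 hr hX hG hTU
  have hp : p.Prime := Fact.out
  by_cases h3 : p = 3
  · subst h3
    exact UpperThreeAnomalousOfPartnerClass.missingUpperBoundAt_gordTwo_three_of_printedFacts_of_twistUnitAt_of_hsieh_of_lzz_of_KY_dvd_of_prop14_of_RH_of_PWL_of_castellaHsieh_signed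
      hF hA hL hdvd h14 hCHσ hRH hPWL W hr hX hG hTU
  · have hp5 : 5 ≤ p := by
      have h2 := hp.two_le
      have h4 : p ≠ 4 := by rintro rfl; exact absurd hp (by decide)
      omega
    exact UpperOfPrintDvd.missingUpperBoundAt_gordTwo_fiveLe_of_printedFacts_of_twistUnitAt_of_hsieh_of_lzz_of_KY_dvd_of_prop14_of_castellaHsieh_signed
      hF hA hL hdvd h14 hCHσ W p hp5 hr hX hG hTU

end Summit.BirchSwinnertonDyer.BirchSwinnertonDyer.Theorems.SchneiderFreeAdditiveX3.UpperWingGordOfPrintRHPWL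

end
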